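import Mathlib
import HarnessLib

/-!
# The class identity of the re-pointing design R♮ (elementary transformation along `Y × {p}`) — a polynomial certificate
# (route `KleimanBFSeeds`, crux K2ᵀ 28148; companion of the crux workfile `MARKMAN-TRANSPORT-LANDHERR-rung1-g4.md` §4.3)

HONEST FRAMING: HELPER `--supports stmt-HodgeConjecture-28148` (crux `TwistNormalisedKleimanSemiregularAnchor`, registered rung
`stub_rung_CMclass_d3 : KleimanAnchorRungCM 3`). A PURE COMMUTATIVE-ALGEBRA certificate (no sheaf, no Chern character of the tree, no
semiregularity): it kernel-checks the one class computation on which the design R♮ of the crux workfile rests, in any commutative ring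
with an element `θ` of square zero annihilating `w`. Nothing here proves the rung, K2ᵀ, `WeilSixfolds`, HC_AV, HC_CM or HC.

THE GEOMETRY IT ABSTRACTS (pen, memo §4.3). On a product `X = Y × E` (`E` an elliptic curve, `Y` an abelian fivefold), `θ := [Y × {p}]`
(`θ² = 0`), `w` a Weil class (`θ·w = 0`, `w|_{Y×p} = 0`), `Ē` a locally free seed of rank `r` for the SPLIT polarized family `h₁ = h_Y + θ`
with `κ(Ē) = P(h₁) + N·w`, `P = Σ c_k X^k` (`c₀ = r`, `c₁ = 0`), `ℓ = c₁(Ē)/r`; `Q` a rank-`sr` locally free quotient of `Ē|_{Y×p}`,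
`E′ := ker(Ē ↠ ι_*Q)`. Grothendieck–Riemann–Roch for `ι` (trivial normal bundle) gives `ch(E′) = ch(Ē) − θ·ch(Q)` and
`κ(E′) = κ(Ē) + θ·(s·κ(Ē) − ch(Q)·e^{−ℓ})` (all products with `θ` only see restrictions to `Y × p`). The non-split polarisation of
the cell `[−b]` on the same variety is `h^♮_b = h_Y + b·θ` («split + (b−1)θ»). THIS FILE PROVES, for every commutative ring: with
`κ := P(h+θ) + N w` and ANY `q` (standing for `ch(Q)·e^{−ℓ}`, restricted),
    `κ + θ·(s·κ − q) = P(h + b·θ) + N·w   ⟺   θ·q = θ·(s·P(h) − (b−1)·P′(h))`,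
i.e. `E′` has the `κ`-class of an `h^♮_b`-seed with the SAME coefficients and the same Weil part iff `ch(Q)·e^{−ℓ}` restricts on `Y × p`
to `s·κ_D − (b−1)·κ′_D` (`κ_D = P(h_D)`, `κ′_D = P′(h_D)`): the «exact class equation» (R5) of the workfile. Ingredient: Mathlib's
first-order Taylor formula `Polynomial.eval_add_of_sq_eq_zero` (`P(x + y) = P(x) + P′(x)·y` for `y² = 0`).

References: [Fulton1998] W. Fulton, Intersection Theory, Thm. 15.2 (GRR) and Example 15.3.2; crux workfile
`Cruxes/TwistNormalisedKleimanSemiregularAnchor/MARKMAN-TRANSPORT-LANDHERR-rung1-g4.md` §4.3.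
-/

-- every declaration of this problem lives in `Summit.HodgeConjecture.HodgeConjecture.…` (summit = sub-problem)
set_option linter.dupNamespace false

noncomputable section

open Polynomial

namespace Summit.HodgeConjecture.HodgeConjecture.Theorems

/-- **First-order Taylor along `b·θ`**: `P(h + b·θ) = P(h) + P′(h)·(b·θ)` when `θ² = 0`. [cite: Fulton1998, Example 15.3.2] -/
theorem eval_add_smul_of_sq_eq_zero {R : Type*} [CommRing R] (P : R[X]) (h θ b : R) (hθ : θ ^ 2 = 0) :
    P.eval (h + b * θ) = P.eval h + P.derivative.eval h * (b * θ) :=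
  P.eval_add_of_sq_eq_zero h (b * θ) (by rw [mul_pow, hθ, mul_zero])

/-- **The class identity of design R♮.** In a commutative ring with `θ² = 0` and `θ·w = 0`, for a polynomial `P` (the `κ`-polynomial of
the split seed), scalars `N, s, b` and any `q` (the restricted `ch(Q)·e^{−ℓ}`), with `κ := P(h+θ) + N·w`:
`κ + θ·(s·κ − q) = P(h + b·θ) + N·w ↔ θ·q = θ·(s·P(h) − (b − 1)·P′(h))`. For `b = 1` the right side reads `θ·q = θ·s·P(h)` (the twist
`Ē(−Y×p)`, `s = 1`, changes nothing); for the first non-split cell `b = 2`: `θ·q = θ·(s·P(h) − P′(h))`.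
[cite: Fulton1998, Thm. 15.2 and Example 15.3.2] -/
theorem repointing_class_identity {R : Type*} [CommRing R] (P : R[X]) (h θ w q N s b : R) (hθ : θ ^ 2 = 0)
    (hθw : θ * w = 0) :
    (P.eval (h + θ) + N * w) + θ * (s * (P.eval (h + θ) + N * w) - q) = P.eval (h + b * θ) + N * w ↔
      θ * q = θ * (s * P.eval h - (b - 1) * P.derivative.eval h) := by
  rw [eval_add_smul_of_sq_eq_zero P h θ b hθ, P.eval_add_of_sq_eq_zero h θ hθ]
  have hθ' : θ * θ = 0 := by rw [← sq, hθ]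
  constructor
  · intro H
    linear_combination (-1 : R) * H + (s * P.derivative.eval h) * hθ' + (s * N) * hθw
  · intro H
    linear_combination (-1 : R) * H + (s * P.derivative.eval h) * hθ' + (s * N) * hθw

/-- **Degree-zero consequence** (rank bookkeeping): specialising `P` to a constant `r` (only `κ₀ = r` retained), the identity forces
`θ·q = θ·(s·r)` — the rank of `Q` is `s·r`, independently of `b`. [cite: Fulton1998, Example 15.3.2] -/
theorem repointing_rank_identity {R : Type*} [CommRing R] (r h θ w q N s b : R) (hθ : θ ^ 2 = 0) (hθw : θ * w = 0) :
    ((C r).eval (h + θ) + N * w) + θ * (s * ((C r).eval (h + θ) + N * w) - q) = (C r).eval (h + b * θ) + N * w ↔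
      θ * q = θ * (s * r) := by
  rw [repointing_class_identity (C r) h θ w q N s b hθ hθw, derivative_C, eval_zero, mul_zero, sub_zero, eval_C]

end Summit.HodgeConjecture.HodgeConjecture.Theorems

end
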